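import Literature.MathematicalPhysics.QuantumFieldTheory.Balaban1983to89.B7Prop7Levels
import Literature.MathematicalPhysics.QuantumFieldTheory.Balaban1983to89.B7Prop4GeneralCk
import Summits.QuantumFields.BalabanUV.T4Continuum.Spine.NE1p.B7AveragingHessianCommuting
import Mathlib.Analysis.Complex.Liouville

/-!
# T⁴ programme, spine estimate NE1′ (node O3b/H2) — DOOR (c) AT EVERY LEVEL `j ≤ k` FOR THE PRINTED COMPOSITE `Q_j` (127): the
# quadratic term of `Q_j(e^{B}U₀, tA)(c)` in the slot amplitude differs from its value at `U₀` by `≤ 8·Lʲ·a²·b∕(β·β′)` at every background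
# `U₀` of the regime (52) — hence «diagonal curvature ∝ non-flatness» for Bałaban's own `Q_j(U₀, ηA)` of Proposition 4 around the flat
# background, from the lineage's kernel Proposition 7 (analyticity in `(A′, A)`) + Cauchy

Cell `pub-balaban-gaps` (YM blitz Y1, track G2), seat `ne1` gen 11 (prover-pub-balaban-gaps-ne1-g11-0); record `HOME/ne/NE1.md` §4 R65.
ADDITIVE — imports the p06∕r04 lineage's `B7Prop7Levels` (KERNEL Proposition 7: `prop7_analyticAt` — «Q_k(U′U₀, ηA) is analytic in complex
variables A′, A» —, `prop7_prop4_uniform` — (131) `‖Q_j(U′U₀, ηB)(c)‖ ≤ 2Lʲb` uniformly in `U′`), `B7Prop4GeneralCk` (`linCovIter_csmul`), and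
this seat's gen-8 `B7AveragingHessianCommuting` (`pdev_one_lt`: (52) at `U₀ = 1`; through it `B7AveragingAbelianSectorRemainder`'s
`eventually_CCovIter_one_smul_eq_zero`: the flat remainder vanishes on abelian slots) BY NAME; the objects `logCovIter` (= the printed
`Q_j(U₀, ηA)`, (127)), `expCfg` (109), `avgIter` (43), `AvgClosed`, `C0`, `c2'`, `c3`, `pdev` are the lineage's; nothing edited or restated; 0 def.

PRINT.  [Balaban1985Averaging] (121) p. 36 `Q(V₀, A, c) = (1∕i) log(V̿₁)_c`; (127) p. 37 and p. 38 «Q_{j+1}(U₀, ηA) = Q(Ū₀ʲ, Q_j(U₀, ηA))»;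
Proposition 4 (130)–(131) p. 38; Proposition 7 p. 43: «For U₀ satisfying (52) and U′ = e^{iηA′}, |A′| < α₁, α₀, α₁ sufficiently small,
the function Q_k(U′U₀, ηA) is analytic in complex variables A′, A, and Proposition 4 holds uniformly in A′.»  Gens 9–11 of this seat
treated the covariant RATIO (65) `Ũ′ = Ū_c(e^{tA}U₀)Ū_c(U₀)⁻¹` at level 1 (files 8–18); THIS file treats the printed `Q_j` itself, at every
level `j ≤ k`, at the backgrounds `U′U₀ = e^{B}U₀` of Proposition 7's ball around ANY background `U₀` of the regime (52) (and then around
the flat one, `U₀ = 1`), by the same two-parameter Cauchy argument as file 16, the holomorphy now being the lineage's Proposition 7.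

WHAT THIS FILE PROVES ([folklore] Cauchy estimates + the lineage's kernel Prop. 7; 0 sorry):
* §1 ABSTRACT TWO-PARAMETER CAUCHY (any complete normed `ℂ`-space): `norm_sub_le_of_twoParam` (Cauchy `n = 1` in `s` on discs of
  radius `R₁` around the points of `[0,1]` + the mean value inequality: `‖G(1,τ) − G(0,τ)‖ ≤ M∕R₁`), `norm_iteratedDeriv_two_le_of_bound`
  (Cauchy `n = 2`: `‖∂_τ²G(s,·)(0)‖ ≤ 2M∕ρ²`), **`norm_iteratedDeriv_two_sub_le_of_twoParam`** (Cauchy `n = 2` on the difference: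
  `‖∂_τ²G(1,·)(0) − ∂_τ²G(0,·)(0)‖ ≤ 2M∕(R₁ρ²)`).
* §2 THE PRINTED `Q_j` AT THE BACKGROUNDS `e^{sB}U₀`, `U₀` ANY background of the regime (`G`-valued, (52) `pdev U₀ < α₀η²`): under the
  Prop.-7 regime DATA at budgets `β` (field) and `β′` (background generator) in level-`k` units (the lineage's displayed smallness
  conditions, carried verbatim as hypotheses; `L ≥ 2`, an averaging-closed gauge group `G ⊂ U1`, `0 < α₀` with `C₀α₀ ≤ 1∕3`, `8α₀ ≤ c₂′`):
  `analyticAt_logCovIter_slot` ∕ `_background` (Prop. 7 along `τ ↦ τA` and along `s ↦ sB`), `norm_logCovIter_ray_le` ((131):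
  `‖Q_j(e^{sB}U₀, τA)(c)‖ ≤ 2Lʲβ` on the polydisc).
* §3 **`norm_levels_curvature_sub_le`** — THE QUADRATIC TERM IS LIPSCHITZ IN THE BACKGROUND ACROSS PROP. 7's BALL, AT EVERY LEVEL AND
  EVERY BACKGROUND OF THE REGIME: for `sup‖A‖ ≤ a`, `0 < a`, `sup‖B‖ ≤ b`, `0 < b`, `2b ≤ β′`, every `j ≤ k` and level-`j` bond `c = (z, κ)`:
  `‖∂_τ²|₀ Q_j(e^{B}U₀, τA)(c) − ∂_τ²|₀ Q_j(U₀, τA)(c)‖ ≤ 8·Lʲ·a²·b∕(β·β′)`; **`norm_levels_curvature_le_of_bound`** (the uniform bound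
  `‖∂_τ²|₀ Q_j(e^{sB}U₀, τA)(c)‖ ≤ 4·Lʲ·a²∕β`, file 15's analogue at every level); and, at the flat background ((52) for `U₀ = 1` is gen 8's
  `pdev_one_lt`), **`norm_levels_curvature_le_of_commute`** — for slots with pairwise commuting values (every one-parameter slot) the
  flat quadratic term VANISHES (gen 8: `Q_j(1, τA)` is `ℂ`-linear in `τ` near `0`, `iteratedDeriv_two_logCovIter_one_of_commute`), so
  `‖∂_τ²|₀ Q_j(e^{B}, τA)(c)‖ ≤ 8·Lʲ·a²·b∕(β·β′)` — «DIAGONAL CURVATURE ∝ NON-FLATNESS» AT EVERY LEVEL `j ≤ k` for the printed `Q_j`, the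
  non-flatness being the size `b` of the background generator in level-`k` units (`2b ≤ β′ ≲ L^{−k}`).
What it does NOT do: the block-local ∕ (44)∕(52)-currency form at level `j` (file 18 is level 1 for the ratio (65)); optimal constants; NODE O.

HONEST FRAMING.  [folklore] Cauchy estimates riding on the lineage's kernel Propositions 4∕7 over its verbatim ℤᵈ model; nothing of
Bałaban's asserted beyond print; NE1′ NOT proved; spine 0∕9; (B) 0∕13; binders 0∕6; one finite T⁴ — NOT ℝ⁴, NOT infinite volume, NOT a
mass gap, NOT Clay.
-/

noncomputable section

open scoped Topology
open NormedSpace Filter Metric Set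

namespace Summit.QuantumFields.BalabanUV.T4Continuum.NE1p.B7AveragingCommutator

open Literature.MathematicalPhysics.QuantumFieldTheory.Balaban1983to89.B7Prop1Explicit
open Literature.MathematicalPhysics.QuantumFieldTheory.Balaban1983to89.B7Prop2Explicit (avgIter pdev C0 c2' AvgClosed)
open Literature.MathematicalPhysics.QuantumFieldTheory.Balaban1983to89.B7Prop3Flat (expCfg c3)
open Literature.MathematicalPhysics.QuantumFieldTheory.Balaban1983to89.B7Prop3GeneralRotated (expCfg_zero)
open Literature.MathematicalPhysics.QuantumFieldTheory.Balaban1983to89.B7Prop4GeneralLevels (logCovIter linCovIter)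
open Literature.MathematicalPhysics.QuantumFieldTheory.Balaban1983to89.B7Prop4GeneralCk (linCovIter_csmul)
open Literature.MathematicalPhysics.QuantumFieldTheory.Balaban1983to89.B7Prop5GeneralInduction (CCovIter)
open Literature.MathematicalPhysics.QuantumFieldTheory.Balaban1983to89.B7Prop7Levels (prop7_analyticAt prop7_prop4_uniform)
open Summit.QuantumFields.BalabanUV.T4Continuum.NE1p.B7AveragingAbelianSector (eventually_CCovIter_one_smul_eq_zero pdev_one_lt)

/-! ## §1 Abstract two-parameter Cauchy estimates -/

section Cauchy

variable {F : Type*} [NormedAddCommGroup F] [NormedSpace ℂ F] [CompleteSpace F]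

omit [CompleteSpace F] in
/-- **Mean value in `s` through Cauchy `n = 1`**: if `u ↦ G u τ` is complex-differentiable at every `‖u‖ ≤ 1 + R₁` and `‖G u τ‖ ≤ M` there,
then `‖G 1 τ − G 0 τ‖ ≤ M∕R₁` (Cauchy on the disc of radius `R₁` around each point of `[0,1]`, then the mean value inequality).
[folklore] -/
theorem norm_sub_le_of_twoParam (G : ℂ → ℂ → F) (τ : ℂ) {R₁ M : ℝ} (hR₁ : 0 < R₁)
    (hdiff : ∀ u : ℂ, ‖u‖ ≤ 1 + R₁ → DifferentiableAt ℂ (fun v => G v τ) u)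
    (hB : ∀ u : ℂ, ‖u‖ ≤ 1 + R₁ → ‖G u τ‖ ≤ M) :
    ‖G 1 τ - G 0 τ‖ ≤ M / R₁ := by
  set H : ℂ → F := fun v => G v τ with hH
  have hseg : ∀ s ∈ segment ℝ (0 : ℂ) 1, ‖s‖ ≤ 1 := by
    intro s hs
    rcases hs with ⟨p, r, hp, hr, hpr, rfl⟩
    simp only [smul_zero, zero_add, norm_smul, mul_one, Real.norm_eq_abs, abs_of_nonneg hr, norm_one]
    linarith
  have hnear : ∀ s : ℂ, ‖s‖ ≤ 1 → ∀ w : ℂ, ‖w - s‖ ≤ R₁ → ‖w‖ ≤ 1 + R₁ := fun s hs w hw =>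
    calc ‖w‖ = ‖s + (w - s)‖ := by rw [add_sub_cancel]
      _ ≤ ‖s‖ + ‖w - s‖ := norm_add_le _ _
      _ ≤ 1 + R₁ := add_le_add hs hw
  have hbound : ∀ s ∈ segment ℝ (0 : ℂ) 1, ‖deriv H s‖ ≤ M / R₁ := by
    intro s hs
    have hs1 := hseg s hs
    have hdisc : DifferentiableOn ℂ H (closedBall s R₁) := fun w hw =>
      (hdiff w (hnear s hs1 w (by simpa [dist_eq_norm] using hw))).differentiableWithinAt
    have hC : ∀ w ∈ sphere s R₁, ‖H w‖ ≤ M := fun w hw =>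
      hB w (hnear s hs1 w (by simpa [dist_eq_norm] using (mem_sphere_iff_norm.1 hw).le))
    exact Complex.norm_deriv_le_of_forall_mem_sphere_norm_le hR₁ (hdisc.diffContOnCl_ball subset_rfl) hC
  have hmv := Convex.norm_image_sub_le_of_norm_deriv_le (fun s hs => hdiff s ((hseg s hs).trans (by linarith)))
    hbound (convex_segment (0 : ℂ) 1) (left_mem_segment ℝ (0 : ℂ) 1) (right_mem_segment ℝ (0 : ℂ) 1)
  simpa [hH] using hmv

/-- **Cauchy `n = 2` in `τ`**: if `τ ↦ G s τ` is complex-differentiable at every `‖τ‖ ≤ ρ` with `‖G s τ‖ ≤ M` there (`0 < ρ`), then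
`‖∂_τ²(G s)(0)‖ ≤ 2M∕ρ²`. [folklore] -/
theorem norm_iteratedDeriv_two_le_of_bound (H : ℂ → F) {ρ M : ℝ} (hρ : 0 < ρ)
    (hτ : ∀ τ : ℂ, ‖τ‖ ≤ ρ → DifferentiableAt ℂ H τ) (hB : ∀ τ : ℂ, ‖τ‖ ≤ ρ → ‖H τ‖ ≤ M) :
    ‖iteratedDeriv 2 H 0‖ ≤ 2 * M / ρ ^ 2 := by
  have hD : DifferentiableOn ℂ H (closedBall (0 : ℂ) ρ) := fun τ hτ' =>
    (hτ τ (by simpa using hτ')).differentiableWithinAt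
  have hC : ∀ z ∈ sphere (0 : ℂ) ρ, ‖H z‖ ≤ M := fun z hz => hB z (by simpa using (mem_sphere_iff_norm.1 hz).le)
  have h := Complex.norm_iteratedDeriv_le_of_forall_mem_sphere_norm_le 2 hρ (hD.diffContOnCl_ball subset_rfl) hC
  have e : ((Nat.factorial 2 : ℕ) : ℝ) * M / ρ ^ 2 = 2 * M / ρ ^ 2 := by rw [Nat.factorial_two]; push_cast; ring
  rwa [e] at h

/-- **The two-parameter estimate** (file 16's argument, abstractly): if `u ↦ G u τ` is differentiable on `‖u‖ ≤ 1 + R₁` for every `‖τ‖ ≤ ρ`,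
`τ ↦ G s τ` is differentiable on `‖τ‖ ≤ ρ` for `s = 0, 1`, and `‖G u τ‖ ≤ M` on the polydisc, then
`‖∂_τ²G(1,·)(0) − ∂_τ²G(0,·)(0)‖ ≤ 2M∕(R₁ρ²)` (mean value in `s`, Cauchy `n = 2` on the difference, `iteratedDeriv_sub`). [folklore] -/
theorem norm_iteratedDeriv_two_sub_le_of_twoParam (G : ℂ → ℂ → F) {ρ R₁ M : ℝ} (hρ : 0 < ρ) (hR₁ : 0 < R₁)
    (hs : ∀ τ : ℂ, ‖τ‖ ≤ ρ → ∀ u : ℂ, ‖u‖ ≤ 1 + R₁ → DifferentiableAt ℂ (fun v => G v τ) u)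
    (h1 : ∀ τ : ℂ, ‖τ‖ ≤ ρ → DifferentiableAt ℂ (G 1) τ) (h0 : ∀ τ : ℂ, ‖τ‖ ≤ ρ → DifferentiableAt ℂ (G 0) τ)
    (hB : ∀ u τ : ℂ, ‖u‖ ≤ 1 + R₁ → ‖τ‖ ≤ ρ → ‖G u τ‖ ≤ M) :
    ‖iteratedDeriv 2 (G 1) 0 - iteratedDeriv 2 (G 0) 0‖ ≤ 2 * (M / R₁) / ρ ^ 2 := by
  have hD1 : DifferentiableOn ℂ (G 1) (closedBall (0 : ℂ) ρ) := fun τ hτ => (h1 τ (by simpa using hτ)).differentiableWithinAt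
  have hD0 : DifferentiableOn ℂ (G 0) (closedBall (0 : ℂ) ρ) := fun τ hτ => (h0 τ (by simpa using hτ)).differentiableWithinAt
  have hA1 : AnalyticAt ℂ (G 1) 0 :=
    (hD1.mono ball_subset_closedBall).analyticAt (ball_mem_nhds 0 hρ)
  have hA0 : AnalyticAt ℂ (G 0) 0 :=
    (hD0.mono ball_subset_closedBall).analyticAt (ball_mem_nhds 0 hρ)
  have hDC : DiffContOnCl ℂ (G 1 - G 0) (ball (0 : ℂ) ρ) :=
    (hD1.diffContOnCl_ball subset_rfl).sub (hD0.diffContOnCl_ball subset_rfl)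
  have hC : ∀ z ∈ sphere (0 : ℂ) ρ, ‖(G 1 - G 0) z‖ ≤ M / R₁ := by
    intro z hz
    have hz' : ‖z‖ ≤ ρ := by simpa using (mem_sphere_iff_norm.1 hz).le
    simpa using norm_sub_le_of_twoParam G z hR₁ (hs z hz') (fun u hu => hB u z hu hz')
  have hmain := Complex.norm_iteratedDeriv_le_of_forall_mem_sphere_norm_le 2 hρ hDC hC
  rw [iteratedDeriv_sub (hA1.contDiffAt.of_le le_top) (hA0.contDiffAt.of_le le_top)] at hmain
  have e : ((Nat.factorial 2 : ℕ) : ℝ) * (M / R₁) / ρ ^ 2 = 2 * (M / R₁) / ρ ^ 2 := by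
    rw [Nat.factorial_two]; push_cast; ring
  rwa [e] at hmain

end Cauchy

/-! ## §2 The printed composite `Q_j` (127) at the backgrounds `e^{sB}`: Prop. 7's analyticity and (131) -/

section Levels

variable {d : ℕ} {𝔸 : Type*} [NormedRing 𝔸] [NormedAlgebra ℂ 𝔸] [CompleteSpace 𝔸] [NormOneClass 𝔸]

variable (L : ℕ) (hL : 2 ≤ L) {G : Subgroup 𝔸ˣ} (hG : AvgClosed d L G) (k : ℕ) {α₀ : ℝ} (hα : 0 < α₀)
  (hα3 : C0 d * α₀ ≤ 1 / 3) (hα8 : 8 * α₀ ≤ c2' d L)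
  {β β' : ℝ} (hβ : 0 < β) (hβ' : 0 < β')
  (hsmall' : Real.exp (4 * (800 * ((d : ℝ) + 1) ^ 2 * ((d : ℝ) + 4)) * α₀)
    * (1 + 8 * (131072 * ((d : ℝ) + 1) ^ 2) * ((L : ℝ) ^ k * β')) ≤ 2)
  (hc₃' : 2 * ((L : ℝ) ^ k * β') ≤ c3 d L) (hb'1 : 409600 * ((d : ℝ) + 1) ^ 2 * ((L : ℝ) ^ k * β') ≤ 1)
  (hsmall : Real.exp (4480 * ((d : ℝ) + 1) ^ 2 * ((d : ℝ) + 4) * α₀ + 240000 * ((d : ℝ) + 1) ^ 3 * ((L : ℝ) ^ k * β'))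
    * (1 + 8 * (2097152 * ((d : ℝ) + 1) ^ 2) * ((L : ℝ) ^ k * β)) ≤ 2)
  (hc₃ : 2 * ((L : ℝ) ^ k * β) ≤ c3 d L / 4)
  {A B : Site d → Fin d → 𝔸} {a b : ℝ} (ha0 : 0 < a) (hb0 : 0 < b)
  (ha : ∀ (x : Site d) (μ : Fin d), ‖A x μ‖ ≤ a) (hb : ∀ (x : Site d) (μ : Fin d), ‖B x μ‖ ≤ b)

include ha in
omit [CompleteSpace 𝔸] [NormOneClass 𝔸] in
/-- size of the slot family: `‖(τA)(b)‖ ≤ ‖τ‖·a`. [folklore] -/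
theorem norm_smul_slot_le (τ : ℂ) (x : Site d) (μ : Fin d) : ‖(τ • A) x μ‖ ≤ ‖τ‖ * a := by
  rw [Pi.smul_apply, Pi.smul_apply, norm_smul]; exact mul_le_mul_of_nonneg_left (ha x μ) (norm_nonneg _)

section General

/-! ### §2–§3a at an ARBITRARY background `U₀` of the regime ((52): `pdev U₀ < α₀η²`, `G`-valued), perturbed to `e^{sB}U₀` -/

variable (U₀ : Site d → Fin d → 𝔸ˣ) (hU₀ : ∀ x κ, U₀ x κ ∈ G) (h52 : pdev U₀ < α₀ * (((L : ℝ) ^ k)⁻¹) ^ 2)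

include hL hG hU₀ hα hα3 hα8 h52 hβ hβ' hsmall' hc₃' hb'1 hsmall hc₃ ha hb in
/-- **Prop. 7 along the slot ray**: for `‖s‖·b ≤ β′` and `‖τ₀‖·a ≤ β`, `τ ↦ Q_j(e^{sB}U₀, τA)(c)` is analytic at `τ₀`, `j ≤ k`
(`prop7_analyticAt` with the constant background family `s·B` and the linear field family `τ·A`, at any background `U₀` of the regime).
[cite: Balaban1985Averaging, Proposition 7 p.43] -/
theorem analyticAt_logCovIter_slot {s τ₀ : ℂ} (hs : ‖s‖ * b ≤ β') (hτ₀ : ‖τ₀‖ * a ≤ β) {j : ℕ} (hj : j ≤ k)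
    (z : Site d) (κ : Fin d) :
    AnalyticAt ℂ (fun τ : ℂ => logCovIter L (expCfg (s • B) * U₀) (τ • A) j z κ) τ₀ :=
  prop7_analyticAt (E := ℂ) L hL hG k U₀ hU₀ hα hα3 hα8 h52 (fun _ : ℂ => s • B)
    (fun _ _ => analyticAt_const) hβ'.le (fun x μ => (norm_smul_slot_le hb s x μ).trans hs) hsmall' hc₃' hb'1
    (fun τ : ℂ => τ • A) (fun x μ => by
      show AnalyticAt ℂ (fun τ : ℂ => τ • A x μ) τ₀
      exact analyticAt_id.smul analyticAt_const)
    hβ.le (fun x μ => (norm_smul_slot_le ha τ₀ x μ).trans hτ₀) hsmall hc₃ j hj z κ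

include hL hG hU₀ hα hα3 hα8 h52 hβ hβ' hsmall' hc₃' hb'1 hsmall hc₃ ha hb in
/-- **Prop. 7 along the background ray**: for `‖s₀‖·b ≤ β′` and `‖τ‖·a ≤ β`, `s ↦ Q_j(e^{sB}U₀, τA)(c)` is analytic at `s₀`, `j ≤ k`
(`prop7_analyticAt` with the linear background family `s·B` and the constant field `τ·A`). [cite: Balaban1985Averaging, Proposition 7 p.43] -/
theorem analyticAt_logCovIter_background {s₀ τ : ℂ} (hs₀ : ‖s₀‖ * b ≤ β') (hτ : ‖τ‖ * a ≤ β) {j : ℕ} (hj : j ≤ k)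
    (z : Site d) (κ : Fin d) :
    AnalyticAt ℂ (fun s : ℂ => logCovIter L (expCfg (s • B) * U₀) (τ • A) j z κ) s₀ :=
  prop7_analyticAt (E := ℂ) L hL hG k U₀ hU₀ hα hα3 hα8 h52 (fun s : ℂ => s • B)
    (fun x μ => by
      show AnalyticAt ℂ (fun s : ℂ => s • B x μ) s₀
      exact analyticAt_id.smul analyticAt_const)
    hβ'.le (fun x μ => (norm_smul_slot_le hb s₀ x μ).trans hs₀) hsmall' hc₃' hb'1
    (fun _ : ℂ => τ • A) (fun _ _ => analyticAt_const) hβ.le (fun x μ => (norm_smul_slot_le ha τ x μ).trans hτ) hsmall hc₃ j hj z κ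

include hL hG hU₀ hα hα3 hα8 h52 hβ hβ' hsmall' hc₃' hb'1 hsmall hc₃ ha hb in
/-- **(131) on the polydisc**: `‖Q_j(e^{sB}U₀, τA)(c)‖ ≤ 2Lʲβ` for `‖s‖·b ≤ β′`, `‖τ‖·a ≤ β`, `j ≤ k` (`prop7_prop4_uniform`, uniformly in
the background perturbation). [cite: Balaban1985Averaging, Proposition 7 p.43, (131) p.38] -/
theorem norm_logCovIter_ray_le {s τ : ℂ} (hs : ‖s‖ * b ≤ β') (hτ : ‖τ‖ * a ≤ β) {j : ℕ} (hj : j ≤ k) (z : Site d) (κ : Fin d) :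
    ‖logCovIter L (expCfg (s • B) * U₀) (τ • A) j z κ‖ ≤ 2 * ((L : ℝ) ^ j * β) :=
  (prop7_prop4_uniform L hL hG k U₀ hU₀ hα hα3 hα8 h52 (s • B) hβ'.le
    (fun x μ => (norm_smul_slot_le hb s x μ).trans hs) hsmall' hc₃' hb'1 (τ • A) hβ.le
    (fun x μ => (norm_smul_slot_le ha τ x μ).trans hτ) hsmall hc₃ j hj).2 z κ

/-! ## §3 The quadratic term of the printed `Q_j` is Lipschitz in the background; «diagonal curvature ∝ non-flatness» -/

include hL hG hU₀ hα hα3 hα8 h52 hβ hβ' hsmall' hc₃' hb'1 hsmall hc₃ ha0 hb0 ha hb in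
/-- **THE QUADRATIC TERM OF THE PRINTED `Q_j` AT `e^{B}U₀` MINUS ITS VALUE AT `U₀` IS `≤ 8Lʲa²b∕(ββ′)`**, at ANY background `U₀` of the
regime ((52), `G`-valued): for `sup‖A‖ ≤ a` (`0 < a`), `sup‖B‖ ≤ b` (`0 < b`, `2b ≤ β′`), every `j ≤ k` and every bond `c = (z, κ)` of the
`j`-th lattice: `‖∂_τ²|₀ Q_j(e^{B}U₀, τA)(c) − ∂_τ²|₀ Q_j(U₀, τA)(c)‖ ≤ 8·Lʲ·a²·b∕(β·β′)`
— §1 with `G(s,τ) = Q_j(e^{sB}U₀, τA)(c)`, `ρ = β∕a`, `R₁ = β′∕(2b)`, `M = 2Lʲβ` (Prop. 7 + (131)). Crude constant; honest exponents `a²·b¹`;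
`β`, `β′` are the Prop.-7 budgets in level-`k` units. [cite: Balaban1985Averaging, Proposition 7 p.43, (131) p.38, (127) p.37] -/
theorem norm_levels_curvature_sub_le (hbβ : 2 * b ≤ β') {j : ℕ} (hj : j ≤ k) (z : Site d) (κ : Fin d) :
    ‖iteratedDeriv 2 (fun τ : ℂ => logCovIter L (expCfg ((1 : ℂ) • B) * U₀) (τ • A) j z κ) 0
        - iteratedDeriv 2 (fun τ : ℂ => logCovIter L (expCfg ((0 : ℂ) • B) * U₀) (τ • A) j z κ) 0‖
      ≤ 8 * (L : ℝ) ^ j * a ^ 2 * b / (β * β') := by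
  set Gf : ℂ → ℂ → 𝔸 := fun s τ => logCovIter L (expCfg (s • B) * U₀) (τ • A) j z κ with hGf
  set ρ : ℝ := β / a with hρ
  set R₁ : ℝ := β' / (2 * b) with hR₁
  have hρ0 : 0 < ρ := by positivity
  have hR₁0 : 0 < R₁ := by positivity
  have hτβ : ∀ τ : ℂ, ‖τ‖ ≤ ρ → ‖τ‖ * a ≤ β := fun τ hτ => by
    have := mul_le_mul_of_nonneg_right hτ ha0.le
    rwa [hρ, div_mul_cancel₀ _ ha0.ne'] at this
  have hsβ : ∀ u : ℂ, ‖u‖ ≤ 1 + R₁ → ‖u‖ * b ≤ β' := fun u hu => by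
    have h1 := mul_le_mul_of_nonneg_right hu hb0.le
    have e : (1 + R₁) * b = b + β' / 2 := by rw [hR₁]; field_simp
    rw [e] at h1
    linarith
  have h := norm_iteratedDeriv_two_sub_le_of_twoParam Gf hρ0 hR₁0
    (fun τ hτ u hu => (analyticAt_logCovIter_background L hL hG k hα hα3 hα8 hβ hβ' hsmall' hc₃' hb'1 hsmall hc₃ ha hb U₀ hU₀ h52
      (hsβ u hu) (hτβ τ hτ) hj z κ).differentiableAt)
    (fun τ hτ => (analyticAt_logCovIter_slot L hL hG k hα hα3 hα8 hβ hβ' hsmall' hc₃' hb'1 hsmall hc₃ ha hb U₀ hU₀ h52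
      (s := 1) (by rw [norm_one, one_mul]; linarith) (hτβ τ hτ) hj z κ).differentiableAt)
    (fun τ hτ => (analyticAt_logCovIter_slot L hL hG k hα hα3 hα8 hβ hβ' hsmall' hc₃' hb'1 hsmall hc₃ ha hb U₀ hU₀ h52
      (s := 0) (by rw [norm_zero, zero_mul]; exact hβ'.le) (hτβ τ hτ) hj z κ).differentiableAt)
    (fun u τ hu hτ => norm_logCovIter_ray_le L hL hG k hα hα3 hα8 hβ hβ' hsmall' hc₃' hb'1 hsmall hc₃ ha hb U₀ hU₀ h52 (hsβ u hu)
      (hτβ τ hτ) hj z κ)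
  have e : 2 * (2 * ((L : ℝ) ^ j * β) / R₁) / ρ ^ 2 = 8 * (L : ℝ) ^ j * a ^ 2 * b / (β * β') := by
    rw [hρ, hR₁]; field_simp; ring
  rw [e] at h
  exact h

include hL hG hU₀ hα hα3 hα8 h52 hβ hβ' hsmall' hc₃' hb'1 hsmall hc₃ ha0 ha hb in
/-- **The uniform second-order bound at every level** (file 15's analogue for the printed `Q_j`, at any background of the regime): for
`‖s‖·b ≤ β′`, `j ≤ k`, `‖∂_τ²|₀ Q_j(e^{sB}U₀, τA)(c)‖ ≤ 4·Lʲ·a²∕β` (Cauchy `n = 2` on `‖τ‖ ≤ β∕a` with (131)).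
[cite: Balaban1985Averaging, Proposition 7 p.43, (131) p.38] -/
theorem norm_levels_curvature_le_of_bound {s : ℂ} (hs : ‖s‖ * b ≤ β') {j : ℕ} (hj : j ≤ k) (z : Site d) (κ : Fin d) :
    ‖iteratedDeriv 2 (fun τ : ℂ => logCovIter L (expCfg (s • B) * U₀) (τ • A) j z κ) 0‖ ≤ 4 * (L : ℝ) ^ j * a ^ 2 / β := by
  set ρ : ℝ := β / a with hρ
  have hρ0 : 0 < ρ := by positivity
  have hτβ : ∀ τ : ℂ, ‖τ‖ ≤ ρ → ‖τ‖ * a ≤ β := fun τ hτ => by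
    have := mul_le_mul_of_nonneg_right hτ ha0.le
    rwa [hρ, div_mul_cancel₀ _ ha0.ne'] at this
  have h := norm_iteratedDeriv_two_le_of_bound (fun τ : ℂ => logCovIter L (expCfg (s • B) * U₀) (τ • A) j z κ) hρ0
    (fun τ hτ => (analyticAt_logCovIter_slot L hL hG k hα hα3 hα8 hβ hβ' hsmall' hc₃' hb'1 hsmall hc₃ ha hb U₀ hU₀ h52 hs (hτβ τ hτ)
      hj z κ).differentiableAt)
    (fun τ hτ => norm_logCovIter_ray_le L hL hG k hα hα3 hα8 hβ hβ' hsmall' hc₃' hb'1 hsmall hc₃ ha hb U₀ hU₀ h52 hs (hτβ τ hτ)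
      hj z κ)
  have e : 2 * (2 * ((L : ℝ) ^ j * β)) / ρ ^ 2 = 4 * (L : ℝ) ^ j * a ^ 2 / β := by
    rw [hρ]; field_simp; ring
  rw [e] at h
  exact h

end General

/-! ### §3b The flat background: the abelian-slot quadratic term vanishes, hence «diagonal curvature ∝ non-flatness» -/

include hL hG hα hα3 hα8 in
/-- **The flat quadratic term of the printed `Q_j` VANISHES on abelian slots**: if the values of `A` pairwise commute then near `τ = 0`
`Q_j(1, τA)(c) = τ·(LʲQ_j(1)A)(c)` (gen 8: the flat remainder `C_j(1, τA)` is `0`, `eventually_CCovIter_one_smul_eq_zero`; the linear part is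
`ℂ`-homogeneous, `linCovIter_csmul`), so `∂_τ²|₀ Q_j(1, τA)(c) = 0`, `j ≤ k`. [cite: Balaban1985Averaging, (134) p.38, (127) p.37] -/
theorem iteratedDeriv_two_logCovIter_one_of_commute (hA : ∀ (x : Site d) (κ : Fin d) (y : Site d) (μ : Fin d), Commute (A x κ) (A y μ))
    {M : ℝ} (hM0 : 0 ≤ M) (hM : ∀ x κ, ‖A x κ‖ ≤ M) {j : ℕ} (hj : j ≤ k) (z : Site d) (κ : Fin d) :
    iteratedDeriv 2 (fun τ : ℂ => logCovIter L (1 : Site d → Fin d → 𝔸ˣ) (τ • A) j z κ) 0 = 0 := by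
  have hL1 : 1 ≤ L := le_trans (by norm_num) hL
  have hα4 : 4 * α₀ ≤ c2' d L := by linarith
  have hev := eventually_CCovIter_one_smul_eq_zero (L := L) hA hL1 hM0 hM j z κ
  have hlin : ∀ τ : ℂ, linCovIter L (1 : Site d → Fin d → 𝔸ˣ) (τ • A) j z κ = τ • linCovIter L (1 : Site d → Fin d → 𝔸ˣ) A j z κ :=
    fun τ => by
      rw [linCovIter_csmul L hL hG k 1 (fun _ _ => G.one_mem) hα hα3 hα4 (pdev_one_lt L hL k hα) τ A j hj]; rfl
  have heq : (fun τ : ℂ => logCovIter L (1 : Site d → Fin d → 𝔸ˣ) (τ • A) j z κ)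
      =ᶠ[𝓝 0] fun τ : ℂ => τ • linCovIter L (1 : Site d → Fin d → 𝔸ˣ) A j z κ := by
    filter_upwards [hev] with τ hτ
    have h0 : logCovIter L (1 : Site d → Fin d → 𝔸ˣ) (τ • A) j z κ - linCovIter L (1 : Site d → Fin d → 𝔸ˣ) (τ • A) j z κ = 0 := hτ
    rw [← hlin τ]; exact sub_eq_zero.1 h0
  rw [heq.iteratedDeriv_eq]
  rw [iteratedDeriv_succ, iteratedDeriv_one]
  have hd : deriv (fun τ : ℂ => τ • linCovIter L (1 : Site d → Fin d → 𝔸ˣ) A j z κ)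
      = fun _ => linCovIter L (1 : Site d → Fin d → 𝔸ˣ) A j z κ := by
    funext τ
    exact ((hasDerivAt_id τ).smul_const _).deriv.trans (by simp)
  rw [hd, deriv_const]

include hL hG hα hα3 hα8 hβ hβ' hsmall' hc₃' hb'1 hsmall hc₃ ha0 hb0 ha hb in
/-- **«DIAGONAL CURVATURE ∝ NON-FLATNESS» AT EVERY LEVEL `j ≤ k` FOR THE PRINTED `Q_j`, ONE-PARAMETER (ABELIAN) SLOTS**: if the values of
`A` pairwise commute, `sup‖A‖ ≤ a` (`0 < a`), `sup‖B‖ ≤ b` (`0 < b`, `2b ≤ β′`), then for every `j ≤ k` and every level-`j` bond `c`: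
`‖∂_τ²|₀ Q_j(e^{B}, τA)(c)‖ ≤ 8·Lʲ·a²·b∕(β·β′)` — zero at the flat background, linear in the size of the background generator (the non-flatness
in level-`k` units), quadratic in the slot amplitude. [cite: Balaban1985Averaging, Proposition 7 p.43, (131) p.38, (134) p.38] -/
theorem norm_levels_curvature_le_of_commute (hbβ : 2 * b ≤ β')
    (hA : ∀ (x : Site d) (κ : Fin d) (y : Site d) (μ : Fin d), Commute (A x κ) (A y μ)) {j : ℕ} (hj : j ≤ k) (z : Site d) (κ : Fin d) :
    ‖iteratedDeriv 2 (fun τ : ℂ => logCovIter L (expCfg B * 1) (τ • A) j z κ) 0‖ ≤ 8 * (L : ℝ) ^ j * a ^ 2 * b / (β * β') := by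
  have h := norm_levels_curvature_sub_le L hL hG k hα hα3 hα8 hβ hβ' hsmall' hc₃' hb'1 hsmall hc₃ ha0 hb0 ha hb 1 (fun _ _ => G.one_mem)
    (pdev_one_lt L hL k hα) hbβ hj z κ
  have eflat : (fun τ : ℂ => logCovIter L (expCfg ((0 : ℂ) • B) * 1) (τ • A) j z κ)
      = fun τ : ℂ => logCovIter L (1 : Site d → Fin d → 𝔸ˣ) (τ • A) j z κ := by
    funext τ; rw [zero_smul, expCfg_zero, one_mul]
  rwa [one_smul, eflat, iteratedDeriv_two_logCovIter_one_of_commute L hL hG k hα hα3 hα8 hA ha0.le ha hj z κ, sub_zero] at h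

end Levels

end Summit.QuantumFields.BalabanUV.T4Continuum.NE1p.B7AveragingCommutator

end
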